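import Summits.BirchSwinnertonDyer.BirchSwinnertonDyer.Theses.GenusKolyvaginAtTwo
import Summits.BirchSwinnertonDyer.BirchSwinnertonDyer.Theorems.GenusKolyvaginAtTwoLeafCensusWallTorsionCell
import Summits.BirchSwinnertonDyer.Rank1Residual.P2.TransportAtTwoShuZhai
import Literature.NumberTheory.EllipticCurves.BSDSelmerCMPConverseGoldfeldProofs
import Literature.NumberTheory.EllipticCurves.Wuthrich2014.ShaBoundProofs
import Literature.NumberTheory.EllipticCurves.AnalyticRankOrderProofs
import Literature.NumberTheory.EllipticCurves.IsogenyIdProofs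
import Literature.NumberTheory.EllipticCurves.IsogenyDualProofs
import Summits.BirchSwinnertonDyer.Rank1Residual.X12.CMIsogenyInvariance
import Summits.BirchSwinnertonDyer.BirchSwinnertonDyer.Theorems.ByReductionTypeAtTwoTwoTorsionIsogenyPairs
import Summits.BirchSwinnertonDyer.BirchSwinnertonDyer.Theorems.ByReductionTypeAtTwoMultTransportTwoIsogenyNormalForm
import Summits.BirchSwinnertonDyer.BirchSwinnertonDyer.Theorems.TwoAdicConverseFullTwoTorsionRamified
import HarnessLib

/-!
# LINE 44 «shu_zhai_cell» v1.2 (ideator seat bsd-idea-1, g31–g32) on the crux R″ =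
# `GenusKolyvaginAtTwo.RankOneTwoTorsionResidualAtTwo` (stmt-BirchSwinnertonDyer-27478; `closes` binder r4, residual)

R″ (verbatim): every globally minimal NON-CM `W/ℚ` of analytic rank `1` WITH a non-zero rational `2`-torsion point
satisfies Miller's `BSD(W, 2)`.  It is the «reducible ρ̄_{E,2}» half of the rank-one leaf: NO Kolyvagin-system line of
the route (LINES 41–43, U₂, the Ш-cell) reaches it, and before this file it carried no skeleton, no line, no evidence.

## The lever (technique card «rigidity»): 2-ADIC VALUATION RIGIDITY ALONG SHU–ZHAI TWIST FAMILIES ⟹ BSD₂ TRANSPORT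
Shu–Zhai 2021 (Crelle 775; arXiv:2102.11808, Thm. 1.2 / Thm. 1.4 = tree named facts `ShuZhai2021.thm12_ranks_of_twists`,
`ShuZhai2021.thm14_twoPartBSD_of_twists`): for an optimal `E/ℚ` with `f([0]) ∉ 2E(ℚ)`, `E(ℚ)[2] ≅ E′(ℚ)[2] ≅ ℤ/2` (Tor),
a prime `p ≡ 3 (4)`, `p > 3`, Heegner for `(E, ℚ(√−p))`, admissible `q₁ … q_r ≠ p`, `M = ∏ qᵢ*`: the twist `E^{(−pM)}` has
analytic rank ONE, and — Manin constant odd, every `ℓ ∣ 2N` split in `ℚ(√−p)` and `ℚ(√M)` — BSD₂(E) ⟹ BSD₂(E^{(−pM)}).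
The `2`-adic valuation of the Heegner-point height / `L′`-value is RIGID (exactly computable) along the family
(generalised Birch lemma, Thm. 4.10), so BSD₂ is TRANSPORTED from the RANK-ZERO base.  On GK2 the base's BSD₂ is
exactly what the four WALL binders give (`bsdp_rankZero_of_wallGK2`: non-CM, `r_an = 0` ⟹ `BSDp · 2`), and the base
IS rank zero (Thm. 1.2 at `r = 0`, tree `P2.base_rankZero_of_shuZhai`) and non-CM (a twist of the non-CM `W`;
`j` is a twist invariant).  Hence the SHU–ZHAI CELL of R″ — the `W` admitting such a presentation — CLOSES modulo
WALL + print, sorry-free in this file (`finite_sha_and_bsdp_of_inShuZhaiCellAtTwo`), re-pointing the P2 cell's transport engine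
`Summit.BirchSwinnertonDyer.Rank1Residual.P2.bsdp_two_twists_of_shuZhai` (built for the Rank1Residual programme,
never attached to GK2's R″) at this binder.  **v1.1 — ISOGENY CLOSURE**: `BSD(E, p)` is a ℚ-ISOGENY INVARIANT
(Cassels 1965; tree `Wuthrich2014.bsdp_of_isIsogenous` from the named fact `bsdRHS_eq_of_isIsogenous`), CM and the
analytic rank are isogeny invariants, and Thm. 1.2 gives `Ш(E^{(−pM)})` finite: so the whole ℚ-ISOGENY CLASS of every
cell member closes too (`bsdp_of_inShuZhaiIsogenyCellAtTwo`) — the `2`-isogenous partner `(E′)^{(−pM)}` and all odd-isogenous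
images; such a class consists of curves with CYCLIC rational `2`-torsion ((Tor) on `E`, `E′`), so only RES-B shrinks (to «off the
isogeny cell»); RES-A is untouched.

## v1.2 — THE REAL LEAF (merge of LINE 45 «real_leaf»): RES-A IS DERIVED, ONE research stub remains
With `x₁, x₂, x₃` the three rational `2`-torsion abscissae of a full-`2`-torsion `W`, the two-torsion normal form at `Tᵢ`
has `bᵢ = 3xᵢ² + (b₂/2)xᵢ + b₄/2 = (xᵢ − xⱼ)(xᵢ − xₖ)` (Vieta), so `b₁b₂b₃ = −((x₁−x₂)(x₁−x₃)(x₂−x₃))² < 0`: the `bᵢ` are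
never all squares (SIGN RIGIDITY, `sign_rigidity_not_all_isSquare`), and for `bᵢ ∉ ℚ²` the partner `W/⟨Tᵢ⟩` has EXACTLY
ONE rational point of order `2`; its globally minimal model is non-CM, `r_an = 1`, CYCLIC, and `BSD₂` transports along the
`ℤ/2`-linked pair (GZK + Cassels + modularity, tree `bsdp_two_iff_of_twoTorsionPair`).  Hence
`fullTwoTorsionResidual_of_cyclic : GZK → Cassels → modularity → CYC → RES-A` (sorry-free) and, since CYC (R″ on cyclic
torsion) is ISOGENY-CELL ⊔ RES-B (`cyclic_of_isogenyCell_and_resB`), the carve becomes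
**R″ ⟸ WALL ×4 + PRINT(Shu–Zhai 1.2 ∧ 1.4 ∧ modularity) + PRINT(Cassels ∧ GZK) + RES-B** — RES-B is the ONLY research stub.

## What is research (v1.2: ONE residual stub — beyond print at `p = 2`)
* (DERIVED since v1.2, no longer a stub) RES-A `FullTwoTorsionRankOneResidualAtTwo`: `W(ℚ)[2] ≅ (ℤ/2)²`, non-CM, `r_an = 1` —
  follows from CYC by the real leaf (§3c); never in the cell nor isogenous to it, but always `2`-isogenous to a CYCLIC curve.
* RES-B `CyclicTwoTorsionOffIsogenyCellResidualAtTwo` (v1.1; v1.0 excluded only the cell, not its isogeny closure):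
  `W(ℚ)[2] ≅ ℤ/2`, off the ISOGENY cell — three populations: (b1) SEMISTABLE `W`
  (a Shu–Zhai rank-one twist is additive `I₀*` at `p`, so semistable curves are never in the cell); (b2) (Tor) fails for
  the isogenous `W′` (`W′(ℚ)[2] ≅ (ℤ/2)²`); (b3) (Tor) holds but no base `E = W^{(D)}` has `f([0]) ∉ 2E(ℚ)` with `D` of
  Shu–Zhai shape.  Intended mechanism: «Eisenstein prime 2» — the `p = 2` analogue of Castella–Grossi–Lee–Skinner's
  anticyclotomic method at Eisenstein primes (Invent. Math. 2022, arXiv:2008.02571: `p > 2` only), i.e. a Kolyvagin /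
  BDP argument for REDUCIBLE `E[2]`; beyond print.  Since v1.2 the partners of full-`2`-torsion curves land here too
  (population (b2) seen from the cyclic side).
WALL (`stub_wallByName`) = the route's own four rank-zero `closes` binders BY NAME; PRINT (`stub_printShuZhai`) =
Shu–Zhai Thm. 1.2 ∧ Thm. 1.4 as named facts ∧ modularity (`hasEntireLFunction_rat`); PRINT (`stub_printCassels`, v1.1) =
Cassels' isogeny invariance of the BSD quotient (`bsdRHS_eq_of_isIsogenous`, Cassels 1965 / Milne ADT I.7.3, a tree named fact)
∧ (v1.2) GZK `rank = r_an ≤ 1` (`rank_eq_analyticRank_of_analyticRank_le_one`, Gross–Zagier 1986 + Kolyvagin 1990, a tree named fact).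

## Kernel-checked here (sorry-free outside the four `stub_*`)
`not_hasCM_of_twist_presentation` (CM is a twist/model invariant, via `j`), `finite_sha_and_bsdp_of_inShuZhaiCellAtTwo`
(THE CELL CLOSES: WALL → Thm 1.2 → Thm 1.4 → modularity → ∀ W non-CM in the cell, `Ш(W)` finite
and `BSDp W 2`), `inShuZhaiIsogenyCellAtTwo_of_inShuZhaiCellAtTwo` (cell ⊆ isogeny cell; API lemma, off the obligation path), `bsdp_of_inShuZhaiIsogenyCellAtTwo`
(THE ISOGENY CELL CLOSES: + Cassels + CM isogeny invariance `X12.hasCM_of_isIsogenous` + `leadingLCoeff_ne_zero_holds`),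
§3c (v1.2, the real leaf): `exists_three_abscissae_of_not_hasCyclic`, `sign_rigidity_not_all_isSquare`, `exists_partner_uniqueTwoTorsion`,
`fullTwoTorsionResidual_of_cyclic` (RES-A ⟸ PRINT + CYC), `cyclic_of_isogenyCell_and_resB` (CYC ⟸ WALL + PRINT + Cassels + RES-B);
`residual_of_inputs` (the carve R″ ⟸ ISOGENY-CELL ⊔ RES-B ⊔ (full ⟹ cyclic), by two `by_cases`), `RankOneTwoTorsionResidualAtTwo_of : R″`
BY NAME.
No summit, no leaf and no crux is proved by this file: R″ stays OPEN (the two residual stubs are open mathematics).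
Bears on: LADDER-BSD v1.5r rung «rank one at 2, reducible residual»; GK2 `closes` binder 27478.
-/

noncomputable section

open scoped Classical MatrixGroups ModularForm
open CongruenceSubgroup NumberField WeierstrassCurve Literature.NumberTheory.EllipticCurves
  Literature.NumberTheory.EllipticCurves.ModularForms
open Literature.NumberTheory.EllipticCurves.ShuZhai2021
open Summit.BirchSwinnertonDyer.BirchSwinnertonDyer.Theses.GenusKolyvaginAtTwo
open Literature.NumberTheory.EllipticCurves.Rank1Residual Literature.NumberTheory.EllipticCurves.Rank1Residual.Typed
  Literature.NumberTheory.EllipticCurves.Greenberg1999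
open Summit.BirchSwinnertonDyer.BirchSwinnertonDyer.Theorems.TwoAdicOffHabitat (bsdp_two_iff_of_twoTorsionPair
  analyticRank_eq_of_twoTorsionPair hasCM_iff_of_twoTorsionPair exists_two_torsion_iff_exists_hasRationalTwoTorsionX)
open Summit.BirchSwinnertonDyer.BirchSwinnertonDyer.Theorems.TwoAdicTwistConverse (vieta_of_three_twoTorsion_roots)
open Summit.BirchSwinnertonDyer.BirchSwinnertonDyer.Theorems.MultTransportTwistedDescent (exists_variableChange_twoTorsionNF
  hasUniqueRationalTwoTorsionX_twoIsogenyCodomain_zero_iff hasUniqueRationalTwoTorsionX_smul_toX_iff)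
open Summit.BirchSwinnertonDyer.BirchSwinnertonDyer.Theorems.GenusExact.Census.TorsionCell (bsdp_rankZero_of_wallGK2)
open Summit.BirchSwinnertonDyer.Rank1Residual.P2 (bsdp_two_twists_of_shuZhai base_rankZero_of_shuZhai
  neg_p_mul_ne_zero_of_thm12Setting exists_globallyMinimal_twist)

namespace Summit.BirchSwinnertonDyer.BirchSwinnertonDyer.Cruxes.RankOneTwoTorsionResidualAtTwo.ShuZhaiCell

/-! ## §0 Definitions: the Shu–Zhai cell and the torsion split -/

/-- **The SHU–ZHAI CELL at `2`.**  `W` admits a SHU–ZHAI PRESENTATION: there are a globally minimal base `E`, a modular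
parametrisation datum `Dt` of level `N_E` with ODD constant `Dt.c` (odd Manin constant), a curve `E′` `2`-isogenous to
`E`, a prime `p` and a finite set `Q` of admissible primes in the setting of Shu–Zhai Thm. 1.2 (`Thm12Setting E Dt E′ p Q`:
optimal datum, `f([0]) ∉ 2E(ℚ)`, (Tor) for `E` and `E′`, `p > 3` prime, `p ≡ 3 (4)`, Heegner for `ℚ(√−p)`, admissible
`q ≠ p`), with every `ℓ ∣ 2N_E` split in `ℚ(√−p)` and in `ℚ(√M)` (`M = ∏_{q∈Q} q*`), such that `W` is ℚ-isomorphic to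
(a model of) the rank-one twist `E^{(−pM)}`.  [cite: ShuZhai2021, Thm. 1.2 / Thm. 1.4 (arXiv:2102.11808 p. 3)] -/
def InShuZhaiCellAtTwo (W : WeierstrassCurve ℚ) : Prop :=
  ∃ (E : WeierstrassCurve ℚ) (_ : E.IsElliptic) (_ : E.IsGloballyMinimal) (_ : NeZero (E.conductorNorm ℤ))
    (Dt : ModularParametrizationData E (E.conductorNorm ℤ)) (E' : WeierstrassCurve ℚ) (p : ℕ) (Q : Finset ℕ),
    Thm12Setting E Dt E' p Q ∧ ¬ (2 : ℤ) ∣ Dt.c ∧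
    AllPrimesSplitInSqrt (2 * E.conductorNorm ℤ) (-(p : ℤ)) ∧
    AllPrimesSplitInSqrt (2 * E.conductorNorm ℤ) (∏ q ∈ Q, qStar q) ∧
    ∃ C : VariableChange ℚ, C • E.quadraticTwist ((-(p : ℤ) * ∏ q ∈ Q, qStar q : ℤ) : ℚ) = W

/-- **The SHU–ZHAI ISOGENY CELL at `2`** (v1.1): `W` is ℚ-isogenous to a globally minimal member of the Shu–Zhai cell.
Closed under ℚ-isogeny by construction; contains the cell (`isIsogenous_self`), the `2`-isogenous partners `(E′)^{(−pM)}`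
and all odd-isogenous images (all with cyclic rational `2`-torsion).  [cite: ShuZhai2021, Thm. 1.2 / Thm. 1.4]
[cite: MilneADT2006, Thm. I.7.3] -/
def InShuZhaiIsogenyCellAtTwo (W : WeierstrassCurve ℚ) : Prop :=
  ∃ (W₁ : WeierstrassCurve ℚ) (_ : W₁.IsElliptic) (_ : W₁.IsGloballyMinimal), IsIsogenous W W₁ ∧ InShuZhaiCellAtTwo W₁

/-- **Cyclic rational `2`-torsion**: at most ONE non-zero rational point killed by `2` (`W(ℚ)[2] ⊆ ℤ/2`).  Its negation
under R″'s hypothesis «some non-zero rational `2`-torsion point» is FULL rational `2`-torsion `(ℤ/2)²`. -/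
def HasCyclicRationalTwoTorsion (W : WeierstrassCurve ℚ) : Prop :=
  ∀ P Q : W.toAffine.Point, 2 • P = 0 → 2 • Q = 0 → P ≠ 0 → Q ≠ 0 → P = Q

/-! ## §1 The obligation Props -/

/-- **RES-A — FULL rational `2`-torsion, rank one, non-CM ⟹ BSD₂** (research; beyond print; unchanged from v1.0).  For
every globally minimal non-CM `W/ℚ` with `r_an(W) = 1` and `W(ℚ)[2] ≅ (ℤ/2)²`: `BSD(W, 2)`.  Never in the Shu–Zhai cell nor
isogenous to it ((Tor) fails).  Print covers only CM instances (congruent-number curves).  Why it might fail to be PROVABLE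
soon: no Euler/Kolyvagin system argument is known for `E[2] ≅ (ℤ/2)²` (maximally reducible); why it is TRUE: it is an
instance of BSD. -/
def FullTwoTorsionRankOneResidualAtTwo : Prop :=
  ∀ (W : WeierstrassCurve ℚ) [W.IsElliptic] [W.IsGloballyMinimal],
    ¬ W.HasCM → W.analyticRank = 1 → (¬ ∀ P : W.toAffine.Point, 2 • P = 0 → P = 0) →
    ¬ HasCyclicRationalTwoTorsion W → BSDp W 2

/-- **RES-B — CYCLIC rational `2`-torsion, rank one, non-CM, OFF the Shu–Zhai ISOGENY cell ⟹ BSD₂** (research; beyond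
print).  Populations: (b1) semistable `W` (an isogeny invariant: never isogenous to a Shu–Zhai rank-one twist, which is
additive `I₀*` at `p`); (b2) `W′(ℚ)[2] ≅ (ℤ/2)²` on the isogenous side and the class misses the cell; (b3) (Tor) holds but
no Shu–Zhai base/parameter presents any member of the class.  Intended mechanism: the `p = 2` («Eisenstein prime 2»)
analogue of Castella–Grossi–Lee–Skinner (arXiv:2008.02571, `p > 2`). -/
def CyclicTwoTorsionOffIsogenyCellResidualAtTwo : Prop :=
  ∀ (W : WeierstrassCurve ℚ) [W.IsElliptic] [W.IsGloballyMinimal],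
    ¬ W.HasCM → W.analyticRank = 1 → (¬ ∀ P : W.toAffine.Point, 2 • P = 0 → P = 0) →
    HasCyclicRationalTwoTorsion W → ¬ InShuZhaiIsogenyCellAtTwo W → BSDp W 2

/-- **CYC — R″ on CYCLIC rational `2`-torsion** (v1.2; = ISOGENY-CELL ⊔ RES-B, `cyclic_of_isogenyCell_and_resB`; text identical
to LINE 45's `CyclicTwoTorsionRankOneAtTwo`). -/
def CyclicTwoTorsionRankOneAtTwo : Prop :=
  ∀ (W : WeierstrassCurve ℚ) [W.IsElliptic] [W.IsGloballyMinimal],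
    ¬ W.HasCM → W.analyticRank = 1 → (¬ ∀ P : W.toAffine.Point, 2 • P = 0 → P = 0) →
    HasCyclicRationalTwoTorsion W → BSDp W 2

/-! ## §2 The registered stubs (the ONLY sorries of this file) -/

/-- WALL — the route's four rank-zero `closes` binders BY NAME (GK2 `closes` binders 19095–19098; NOT re-proved here:
this stub is discharged by the route's own hypotheses when the line is glued into `closes`). -/
theorem stub_wallByName :
    WallGoodOrdinaryRankZeroAtTwo ∧ WallMultiplicativeRankZeroAtTwo ∧
      WallSupersingularRankZeroAtTwo ∧ WallAdditiveRankZeroAtTwo := by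
  sorry

/-- PRINT — Shu–Zhai 2021 Thm. 1.2 and Thm. 1.4 AS PRINTED (tree named facts, nothing asserted by the tree) and the
modularity of `E/ℚ` (`hasEntireLFunction_rat`; Wiles, BCDT).  [cite: ShuZhai2021, Thm. 1.2, Thm. 1.4] -/
theorem stub_printShuZhai : thm12_ranks_of_twists ∧ thm14_twoPartBSD_of_twists ∧ hasEntireLFunction_rat := by
  sorry

/-- PRINT (v1.1/v1.2) — Cassels' isogeny invariance of the BSD quotient (tree named fact `bsdRHS_eq_of_isIsogenous`: `W ∼ W′`,
`Ш(W)` finite ⟹ `Ш(W′)` finite and `bsdRHS W′ = bsdRHS W`) AND (v1.2) Gross–Zagier–Kolyvagin `rank = r_an` for `r_an ≤ 1`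
(tree named fact `rank_eq_analyticRank_of_analyticRank_le_one`), AS PRINTED; nothing asserted by the tree.
[cite: Cassels1965ArithmeticVIII] [cite: MilneADT2006, Thm. I.7.3 and Remark I.7.4] [cite: GrossZagier1986] [cite: Kolyvagin1990] -/
theorem stub_printCasselsGZK : bsdRHS_eq_of_isIsogenous ∧ rank_eq_analyticRank_of_analyticRank_le_one := by
  sorry

/-- RES-B (research). -/
theorem stub_cyclicOffIsogenyCellResidual : CyclicTwoTorsionOffIsogenyCellResidualAtTwo := by
  sorry

/-! ## §3 Kernel-checked: the Shu–Zhai cell closes modulo WALL + print -/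

/-- CM is a twist/model invariant: if some model of a quadratic twist of `E` is non-CM then `E` is non-CM
(`j(C • V) = j(V)`, `j(E^{(d)}) = j(E)`, and over `ℚ` `HasCM ↔ j ∈ cmJInvariants`). -/
theorem not_hasCM_of_twist_presentation {E : WeierstrassCurve ℚ} [E.IsElliptic] {d : ℚ} (hd : d ≠ 0)
    (C : VariableChange ℚ) (h : ¬ (C • E.quadraticTwist d).HasCM) : ¬ E.HasCM := by
  intro hE
  haveI := E.isElliptic_quadraticTwist hd
  have h1 : (E.quadraticTwist d).HasCM := hasCM_quadraticTwist_of_hasCM E hE hd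
  have hiff := hasCM_iff_j_mem_of_heegnerStarkPrime
    Literature.NumberTheory.QuadraticFields.BinaryQuadraticForm.HeegnerStarkPrimeThreeModEight_holds
  apply h
  rw [hiff (C • E.quadraticTwist d), WeierstrassCurve.variableChange_j]
  exact (hiff _).1 h1

/-- **THE SHU–ZHAI CELL OF R″ CLOSES** modulo the four WALL rows, Shu–Zhai Thm. 1.2 / 1.4 as printed and modularity:
every globally minimal non-CM `W` in the cell satisfies `BSD(W, 2)`.  Chain: presentation `W ≅ E^{(−pM)}` ⟶ `E` non-CM
(`not_hasCM_of_twist_presentation`) ⟶ `r_an(E) = 0` (Thm 1.2 at `r = 0`, `P2.base_rankZero_of_shuZhai`) ⟶ `BSD(E,2)`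
(WALL, `bsdp_rankZero_of_wallGK2`) ⟶ `BSD(E^{(−pM)}, 2)` at the model `W` (Thm 1.4 + modularity bridge,
`P2.bsdp_two_twists_of_shuZhai`). -/
theorem finite_sha_and_bsdp_of_inShuZhaiCellAtTwo
    (hOrd : WallGoodOrdinaryRankZeroAtTwo) (hMult : WallMultiplicativeRankZeroAtTwo)
    (hSS : WallSupersingularRankZeroAtTwo) (hAdd : WallAdditiveRankZeroAtTwo)
    (h12 : thm12_ranks_of_twists) (h14 : thm14_twoPartBSD_of_twists) (hmod : hasEntireLFunction_rat)
    (W : WeierstrassCurve ℚ) [W.IsElliptic] [W.IsGloballyMinimal] (hcm : ¬ W.HasCM)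
    (hcell : InShuZhaiCellAtTwo W) : Finite W.sha ∧ BSDp W 2 := by
  obtain ⟨E, hEll, hMin, hNe, Dt, E', p, Q, hS, hc, hK, hQM, C, hCW⟩ := hcell
  haveI := hEll; haveI := hMin; haveI := hNe
  -- the twisting parameters are non-zero
  have hQ0 : ∀ q ∈ Q, (q : ℤ) ≠ 0 := fun q hq ↦ by
    exact_mod_cast (hS.2.2.2.2.2.2.2.2.2 q hq).1.1.ne_zero
  have hd : ((-(p : ℤ) * ∏ q ∈ Q, qStar q : ℤ) : ℚ) ≠ 0 := neg_p_mul_ne_zero_of_thm12Setting hS Q hQ0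
  have hM : ((∏ q ∈ Q, qStar q : ℤ) : ℚ) ≠ 0 := by
    have h := hd
    push_cast at h ⊢
    exact (mul_ne_zero_iff.mp h).2
  -- the base is non-CM (twist invariance of CM) and has analytic rank zero (Thm 1.2 at r = 0)
  have hEcm : ¬ E.HasCM := not_hasCM_of_twist_presentation hd C (hCW ▸ hcm)
  have hE0 : E.analyticRank = 0 := (base_rankZero_of_shuZhai h12 hS).1
  -- WALL: BSD₂ of the rank-zero non-CM base
  have hbase : BSDp E 2 := bsdp_rankZero_of_wallGK2 hOrd hMult hSS hAdd E hEcm hE0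
  -- a globally minimal model of the rank-zero companion `E^{(M)}` (the transport theorem treats the pair)
  obtain ⟨WM, _, _, hWM⟩ := exists_globallyMinimal_twist E hM
  -- transport (Thm 1.4 + the GZK-free modularity bridge of the P2 cell), read at the model `W` of `E^{(−pM)}`
  subst hCW
  -- Thm 1.2 also gives `Ш(E^{(−pM)})` finite (read at the model); Thm 1.4 + bridge gives `BSDp · 2`
  exact ⟨(h12 E Dt E' p Q hS WM _ hWM ⟨C, rfl⟩).2.2.2.2.2,
    (bsdp_two_twists_of_shuZhai h12 h14 hmod hS hWM ⟨C, rfl⟩ hc hK hQM hbase).2.2⟩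

/-! ## §3b Kernel-checked (v1.1): the ISOGENY cell closes modulo WALL + print + Cassels -/

/-- The cell lies in the isogeny cell (identity isogeny). -/
theorem inShuZhaiIsogenyCellAtTwo_of_inShuZhaiCellAtTwo (W : WeierstrassCurve ℚ) [W.IsElliptic] [W.IsGloballyMinimal]
    (h : InShuZhaiCellAtTwo W) : InShuZhaiIsogenyCellAtTwo W :=
  ⟨W, ‹_›, ‹_›, isIsogenous_self W, h⟩

/-- **THE SHU–ZHAI ISOGENY CELL OF R″ CLOSES** modulo WALL ×4, Shu–Zhai Thm. 1.2 / 1.4, modularity and Cassels' isogeny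
invariance: if the non-CM `W` is ℚ-isogenous to a globally minimal cell member `W₁`, then `W₁` is non-CM
(`X12.hasCM_of_isIsogenous`), `Ш(W₁)` is finite and `BSD(W₁, 2)` holds (§3), `L^{(r)}(W₁,1)/r! ≠ 0` (modularity,
`leadingLCoeff_ne_zero_holds`), hence `BSD(W, 2)` (`Wuthrich2014.bsdp_of_isIsogenous`).  This covers the `2`-isogenous
partners `(E′)^{(−pM)}` and all odd-isogenous images of cell members (non-optimal presentations included). -/
theorem bsdp_of_inShuZhaiIsogenyCellAtTwo
    (hOrd : WallGoodOrdinaryRankZeroAtTwo) (hMult : WallMultiplicativeRankZeroAtTwo)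
    (hSS : WallSupersingularRankZeroAtTwo) (hAdd : WallAdditiveRankZeroAtTwo)
    (h12 : thm12_ranks_of_twists) (h14 : thm14_twoPartBSD_of_twists) (hmod : hasEntireLFunction_rat)
    (hCassels : bsdRHS_eq_of_isIsogenous)
    (W : WeierstrassCurve ℚ) [W.IsElliptic] [W.IsGloballyMinimal] (hcm : ¬ W.HasCM)
    (h : InShuZhaiIsogenyCellAtTwo W) : BSDp W 2 := by
  obtain ⟨W₁, hEll₁, hMin₁, hiso, hcell₁⟩ := h
  haveI := hEll₁; haveI := hMin₁
  -- CM is an isogeny invariant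
  have hcm₁ : ¬ W₁.HasCM := fun h₁ ↦
    hcm (Summit.BirchSwinnertonDyer.Rank1Residual.X12.hasCM_of_isIsogenous hiso.symm_of_charZero h₁)
  obtain ⟨hfin₁, hbsd₁⟩ :=
    finite_sha_and_bsdp_of_inShuZhaiCellAtTwo hOrd hMult hSS hAdd h12 h14 hmod W₁ hcm₁ hcell₁
  have hlead₁ : W₁.leadingLCoeff ≠ 0 := W₁.leadingLCoeff_ne_zero_holds (hmod W₁)
  exact Wuthrich2014.bsdp_of_isIsogenous hCassels hiso hfin₁ hlead₁ hbsd₁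

/-! ## §3c Kernel-checked (v1.2, merge of LINE 45 «real_leaf»): THE REAL LEAF — full ⟹ cyclic

### Points of order two and their abscissae -/

section Points

variable {W : WeierstrassCurve ℚ}

/-- A non-zero rational point killed by `2` is an affine point `(x, y)` with `2y + a₁x + a₃ = 0`.
[cite: SilvermanAEC2009, III.2.3] -/
theorem exists_xy_of_two_nsmul_eq_zero {P : W.toAffine.Point} (hP0 : P ≠ 0) (h2 : 2 • P = 0) :
    ∃ (x y : ℚ) (h : W.toAffine.Nonsingular x y), P = .some x y h ∧ 2 * y + W.a₁ * x + W.a₃ = 0 := by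
  rcases P with _ | ⟨x, y, hns⟩
  · exact absurd rfl hP0
  · refine ⟨x, y, hns, rfl, ?_⟩
    by_contra hy'
    have hy : y ≠ W.toAffine.negY x y := by
      intro h
      apply hy'
      rw [WeierstrassCurve.Affine.negY] at h
      linear_combination h
    rw [two_nsmul, WeierstrassCurve.Affine.Point.add_self_of_Y_ne hy] at h2
    exact WeierstrassCurve.Affine.Point.some_ne_zero _ h2

/-- A rational point of order `2` is determined by its abscissa (`y = −(a₁x + a₃)/2`). [cite: SilvermanAEC2009, III.2.3] -/
theorem some_eq_some_of_two_torsion {x y₁ y₂ : ℚ} (h₁ : W.toAffine.Nonsingular x y₁) (h₂ : W.toAffine.Nonsingular x y₂)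
    (e₁ : 2 * y₁ + W.a₁ * x + W.a₃ = 0) (e₂ : 2 * y₂ + W.a₁ * x + W.a₃ = 0) :
    (WeierstrassCurve.Affine.Point.some x y₁ h₁ : W.toAffine.Point) = .some x y₂ h₂ := by
  have hy : y₁ = y₂ := by linarith
  subst hy
  rfl

/-- **`(ℤ/2)² ⊆ W(ℚ)` ⟹ three pairwise distinct rational `2`-torsion abscissae** (the tree's spelling of «full rational
`2`-torsion», e.g. in `matsuno2008_prop62_lambda_fullTwoTorsion_two`): two distinct non-zero points `P, Q` killed by `2`
and their sum.  [cite: SilvermanAEC2009, III.2.3] -/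
theorem exists_three_abscissae_of_not_hasCyclic (hfull : ¬ HasCyclicRationalTwoTorsion W) :
    ∃ x₁ x₂ x₃ : ℚ, x₁ ≠ x₂ ∧ x₁ ≠ x₃ ∧ x₂ ≠ x₃ ∧ HasRationalTwoTorsionX W x₁ ∧
      HasRationalTwoTorsionX W x₂ ∧ HasRationalTwoTorsionX W x₃ := by
  unfold HasCyclicRationalTwoTorsion at hfull
  push Not at hfull
  obtain ⟨P, Q, h2P, h2Q, hP0, hQ0, hPQ⟩ := hfull
  -- the third point `R = P + Q`
  have hnegP : -P = P := by
    rw [neg_eq_iff_add_eq_zero, ← two_nsmul]; exact h2P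
  have h2R : 2 • (P + Q) = 0 := by rw [nsmul_add, h2P, h2Q, add_zero]
  have hR0 : P + Q ≠ 0 := by
    intro h
    have hQ : Q = -P := eq_neg_of_add_eq_zero_right h
    rw [hnegP] at hQ
    exact hPQ hQ.symm
  have hRP : P + Q ≠ P := fun h ↦ hQ0 (add_left_cancel (h.trans (add_zero P).symm))
  have hRQ : P + Q ≠ Q := fun h ↦ hP0 (add_right_cancel (h.trans (zero_add Q).symm))
  obtain ⟨xP, yP, hP, rfl, eP⟩ := exists_xy_of_two_nsmul_eq_zero hP0 h2P
  obtain ⟨xQ, yQ, hQ, rfl, eQ⟩ := exists_xy_of_two_nsmul_eq_zero hQ0 h2Q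
  obtain ⟨xR, yR, hR, hReq, eR⟩ := exists_xy_of_two_nsmul_eq_zero hR0 h2R
  refine ⟨xP, xQ, xR, ?_, ?_, ?_, ⟨yP, hP.left, eP⟩, ⟨yQ, hQ.left, eQ⟩, ⟨yR, hR.left, eR⟩⟩
  · rintro rfl
    exact hPQ (some_eq_some_of_two_torsion hP hQ eP eQ)
  · rintro rfl
    exact hRP (hReq.trans (some_eq_some_of_two_torsion hR hP eR eP))
  · rintro rfl
    exact hRQ (hReq.trans (some_eq_some_of_two_torsion hR hQ eR eQ))

/-- Conversely, a UNIQUE rational `2`-torsion abscissa means cyclic rational `2`-torsion. [cite: SilvermanAEC2009, III.2.3] -/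
theorem hasCyclic_of_hasUniqueRationalTwoTorsionX {x : ℚ} (h : HasUniqueRationalTwoTorsionX W x) :
    HasCyclicRationalTwoTorsion W := by
  intro P Q h2P h2Q hP0 hQ0
  obtain ⟨xP, yP, hP, rfl, eP⟩ := exists_xy_of_two_nsmul_eq_zero hP0 h2P
  obtain ⟨xQ, yQ, hQ, rfl, eQ⟩ := exists_xy_of_two_nsmul_eq_zero hQ0 h2Q
  have hxP : xP = x := h.2 xP ⟨yP, hP.left, eP⟩
  have hxQ : xQ = x := h.2 xQ ⟨yQ, hQ.left, eQ⟩
  subst hxP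
  subst hxQ
  exact some_eq_some_of_two_torsion hP hQ eP eQ

end Points

/-! ### SIGN RIGIDITY — the three normal-form coefficients are never all squares -/

/-- **Sign rigidity.**  For three pairwise distinct rational `2`-torsion abscissae `x₁, x₂, x₃` of `W`, the normal-form
coefficients `bᵢ = 3xᵢ² + (b₂/2)xᵢ + b₄/2 = (xᵢ − xⱼ)(xᵢ − xₖ)` have product `−((x₁−x₂)(x₁−x₃)(x₂−x₃))² < 0`; hence NOT all
three are squares in `ℚ`.  [cite: SilvermanAEC2009, III.2.3 (ψ₂) and III.4 Ex. 4.5] -/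
theorem sign_rigidity_not_all_isSquare (W : WeierstrassCurve ℚ) {x₁ x₂ x₃ : ℚ} (h12 : x₁ ≠ x₂) (h13 : x₁ ≠ x₃)
    (h23 : x₂ ≠ x₃) (h₁ : HasRationalTwoTorsionX W x₁) (h₂ : HasRationalTwoTorsionX W x₂)
    (h₃ : HasRationalTwoTorsionX W x₃) :
    ∃ x : ℚ, HasRationalTwoTorsionX W x ∧ ¬ IsSquare (3 * x ^ 2 + W.b₂ / 2 * x + W.b₄ / 2) := by
  obtain ⟨y₁, hE₁, e₁⟩ := h₁
  obtain ⟨y₂, hE₂, e₂⟩ := h₂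
  obtain ⟨y₃, hE₃, e₃⟩ := h₃
  obtain ⟨hS, hS₂, -⟩ := vieta_of_three_twoTorsion_roots (fourXCubed_add_eq_zero_of_twoTorsion hE₁ e₁)
    (fourXCubed_add_eq_zero_of_twoTorsion hE₂ e₂) (fourXCubed_add_eq_zero_of_twoTorsion hE₃ e₃) h12 h13 h23
  by_contra hall
  push Not at hall
  obtain ⟨r₁, hr₁⟩ := hall x₁ ⟨y₁, hE₁, e₁⟩
  obtain ⟨r₂, hr₂⟩ := hall x₂ ⟨y₂, hE₂, e₂⟩
  obtain ⟨r₃, hr₃⟩ := hall x₃ ⟨y₃, hE₃, e₃⟩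
  -- the product of the three coefficients is minus a non-zero square
  have hD : (x₁ - x₂) * (x₁ - x₃) * (x₂ - x₃) ≠ 0 :=
    mul_ne_zero (mul_ne_zero (sub_ne_zero.mpr h12) (sub_ne_zero.mpr h13)) (sub_ne_zero.mpr h23)
  have hprod : (3 * x₁ ^ 2 + W.b₂ / 2 * x₁ + W.b₄ / 2) * (3 * x₂ ^ 2 + W.b₂ / 2 * x₂ + W.b₄ / 2) *
      (3 * x₃ ^ 2 + W.b₂ / 2 * x₃ + W.b₄ / 2) = -(((x₁ - x₂) * (x₁ - x₃) * (x₂ - x₃)) ^ 2) := by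
    have eb₂ : W.b₂ = -4 * (x₁ + x₂ + x₃) := by linear_combination hS
    have eb₄ : W.b₄ = 2 * (x₁ * x₂ + x₁ * x₃ + x₂ * x₃) := by linear_combination (-(1 : ℚ) / 2) * hS₂
    rw [eb₂, eb₄]; ring
  have hpos : 0 < ((x₁ - x₂) * (x₁ - x₃) * (x₂ - x₃)) ^ 2 := by positivity
  have hsq : 0 ≤ (r₁ * r₂ * r₃) * (r₁ * r₂ * r₃) := mul_self_nonneg _
  have hprod' : (3 * x₁ ^ 2 + W.b₂ / 2 * x₁ + W.b₄ / 2) * (3 * x₂ ^ 2 + W.b₂ / 2 * x₂ + W.b₄ / 2) *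
      (3 * x₃ ^ 2 + W.b₂ / 2 * x₃ + W.b₄ / 2) = (r₁ * r₂ * r₃) * (r₁ * r₂ * r₃) := by
    rw [hr₁, hr₂, hr₃]; ring
  rw [hprod'] at hprod
  linarith

/-! ### The CYCLIC PARTNER and the transport -/

/-- **The cyclic partner.**  A curve with full rational `2`-torsion is in two-torsion normal form (after a change of variables
`C`) at a point `Tᵢ` whose normal-form coefficient `b = (C • W).a₄` is NOT a square; Silverman's `2`-isogeny quotient
`(C • W).twoIsogenyCodomain` then has EXACTLY ONE rational point of order `2`.  [cite: SilvermanAEC2009, III.4 Ex. 4.5, X.4 Prop. 4.9] -/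
theorem exists_partner_uniqueTwoTorsion (W : WeierstrassCurve ℚ) [W.IsElliptic] (hfull : ¬ HasCyclicRationalTwoTorsion W) :
    ∃ C : VariableChange ℚ, (C • W).IsTwoTorsionNF ∧ HasUniqueRationalTwoTorsionX (C • W).twoIsogenyCodomain 0 := by
  obtain ⟨x₁, x₂, x₃, h12, h13, h23, h₁, h₂, h₃⟩ := exists_three_abscissae_of_not_hasCyclic hfull
  obtain ⟨x₀, ⟨y₀, hEq, h2⟩, hnsq⟩ := sign_rigidity_not_all_isSquare W h12 h13 h23 h₁ h₂ h₃
  obtain ⟨C, hNF, -, -, -, ha₄⟩ := exists_variableChange_twoTorsionNF W hEq h2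
  haveI := hNF
  refine ⟨C, hNF, ?_⟩
  rw [hasUniqueRationalTwoTorsionX_twoIsogenyCodomain_zero_iff (C • W), ha₄]
  exact hnsq

/-- **RES-A IS DERIVED: full ⟹ cyclic** (the theorem of this line).  Modulo PRINT {GZK, Cassels, modularity}: if `BSD(·,2)`
holds on the globally minimal non-CM rank-one curves with cyclic non-trivial rational `2`-torsion, it holds on those with full
rational `2`-torsion — pass to the globally minimal model `W′` of the cyclic partner (`r_an`, CM are isogeny invariants; the
unique rational `2`-torsion abscissa moves along the change of variables) and transport `BSD₂` back along the `ℤ/2`-linked pair.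
[cite: MilneADT2006, Thm. I.7.3] [cite: Cassels1965ArithmeticVIII] [cite: SilvermanAEC2009, III.4 Ex. 4.5] -/
theorem fullTwoTorsionResidual_of_cyclic (hGZK : rank_eq_analyticRank_of_analyticRank_le_one)
    (hCassels : bsdRHS_eq_of_isIsogenous) (hmod : hasEntireLFunction_rat) (hcyc : CyclicTwoTorsionRankOneAtTwo) :
    FullTwoTorsionRankOneResidualAtTwo := by
  intro W _ _ hCM hr hT hfull
  obtain ⟨C, hNF, huniq⟩ := exists_partner_uniqueTwoTorsion W hfull
  haveI := hNF
  obtain ⟨C₀, hmin⟩ := hasGlobalMinimalModel_rat_holds (C • W).twoIsogenyCodomain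
  set W' : WeierstrassCurve ℚ := C₀ • (C • W).twoIsogenyCodomain with hW'
  haveI : W'.IsGloballyMinimal := hmin
  have hlink : C₀⁻¹ • W' = (C • W).twoIsogenyCodomain := inv_smul_smul C₀ _
  have hCM' : ¬ W'.HasCM := fun h ↦ hCM ((hasCM_iff_of_twoTorsionPair hlink).mpr h)
  have hr' : W'.analyticRank = 1 := (analyticRank_eq_of_twoTorsionPair hlink) ▸ hr
  have huniq' : HasUniqueRationalTwoTorsionX W' (C₀.toX 0) :=
    (hasUniqueRationalTwoTorsionX_smul_toX_iff (C • W).twoIsogenyCodomain C₀ 0).mpr huniq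
  have hT' : ¬ ∀ P : W'.toAffine.Point, 2 • P = 0 → P = 0 := by
    obtain ⟨P, hP0, h2P⟩ := (exists_two_torsion_iff_exists_hasRationalTwoTorsionX W').mpr ⟨_, huniq'.1⟩
    exact fun h ↦ hP0 (h P h2P)
  have h' : BSDp W' 2 := hcyc W' hCM' hr' hT' (hasCyclic_of_hasUniqueRationalTwoTorsionX huniq')
  exact (bsdp_two_iff_of_twoTorsionPair hGZK hCassels hmod hlink hr.le).mpr h'

/-- **CYC from the isogeny cell and RES-B** (v1.2): on cyclic rational `2`-torsion, R″ is the CLOSED Shu–Zhai isogeny cell (§3b)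
or RES-B. -/
theorem cyclic_of_isogenyCell_and_resB
    (hW : WallGoodOrdinaryRankZeroAtTwo ∧ WallMultiplicativeRankZeroAtTwo ∧
      WallSupersingularRankZeroAtTwo ∧ WallAdditiveRankZeroAtTwo)
    (hP : thm12_ranks_of_twists ∧ thm14_twoPartBSD_of_twists ∧ hasEntireLFunction_rat)
    (hC : bsdRHS_eq_of_isIsogenous) (hB : CyclicTwoTorsionOffIsogenyCellResidualAtTwo) :
    CyclicTwoTorsionRankOneAtTwo := by
  intro W _ _ hcm hr hT hcyc
  by_cases hcell : InShuZhaiIsogenyCellAtTwo W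
  · exact bsdp_of_inShuZhaiIsogenyCellAtTwo hW.1 hW.2.1 hW.2.2.1 hW.2.2.2 hP.1 hP.2.1 hP.2.2 hC W hcm hcell
  · exact hB W hcm hr hT hcyc hcell

/-! ## §4 Kernel-checked: the carve and the crux BY NAME -/

/-- **R″ from its inputs** (v1.2): WALL ×4, PRINT (Thm 1.2 ∧ Thm 1.4 ∧ modularity), PRINT (Cassels ∧ GZK), RES-B ⟹ R″.
Cyclic rational `2`-torsion: the isogeny cell (closed, §3b) or RES-B; full rational `2`-torsion: the real leaf (§3c) moves to
a cyclic `2`-isogenous partner and transports back. -/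
theorem residual_of_inputs
    (hW : WallGoodOrdinaryRankZeroAtTwo ∧ WallMultiplicativeRankZeroAtTwo ∧
      WallSupersingularRankZeroAtTwo ∧ WallAdditiveRankZeroAtTwo)
    (hP : thm12_ranks_of_twists ∧ thm14_twoPartBSD_of_twists ∧ hasEntireLFunction_rat)
    (hC : bsdRHS_eq_of_isIsogenous ∧ rank_eq_analyticRank_of_analyticRank_le_one)
    (hB : CyclicTwoTorsionOffIsogenyCellResidualAtTwo) :
    RankOneTwoTorsionResidualAtTwo := by
  have hcyc : CyclicTwoTorsionRankOneAtTwo := cyclic_of_isogenyCell_and_resB hW hP hC.1 hB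
  intro W _ _ hcm hr hT
  by_cases h : HasCyclicRationalTwoTorsion W
  · exact hcyc W hcm hr hT h
  · exact fullTwoTorsionResidual_of_cyclic hC.2 hC.1 hP.2.2 hcyc W hcm hr hT h

/-- **The crux BY NAME** (proof-of-item shape): `GenusKolyvaginAtTwo.RankOneTwoTorsionResidualAtTwo` from the four
registered stubs.  OPEN mathematics lives in `stub_cyclicOffIsogenyCellResidual` ONLY (v1.2). -/
theorem RankOneTwoTorsionResidualAtTwo_of : RankOneTwoTorsionResidualAtTwo :=
  residual_of_inputs stub_wallByName stub_printShuZhai stub_printCasselsGZK stub_cyclicOffIsogenyCellResidual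

end Summit.BirchSwinnertonDyer.BirchSwinnertonDyer.Cruxes.RankOneTwoTorsionResidualAtTwo.ShuZhaiCell

end
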